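import Mathlib
import Literature.Geometry.DiscreteGeometry.TwoShellPatterns

/-!
# The cuboctahedron directions `1/4`-cover the sphere (line `Sketch`, stub `stub_coverFcc`)

Support file for the crux `PhononSlackCertificates.NearFarGlueR` (stmt-AtomisticToContinuum-14970),
line `Sketch`.  The line reduces the crux to a residual contact gap through a DESCENT lemma (from a
bad particle one steps, through the first coordination shell of a good particle, strictly closer);
its geometric input for the fcc pattern is proved here: for every unit vector `w` of `ℝ³` one of the
twelve first-shell (unit) vectors `v` of `fccTwoShellPattern` — the vertices `(±1, ±1, 0)/√2` and
permutations of the cuboctahedron — satisfies `⟪v, w⟫ ≥ 1/4` (the true covering radius is `45°`,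
i.e. `⟪v, w⟫ ≥ 1/√2 · …`; the line only needs `1/4`).

PROOF (sign trick, no sums over the pattern).  Choose signs `a, b, c ∈ {±1}` with `a w₀ = |w₀|`,
`b w₁ = |w₁|`, `c w₂ = |w₂|`.  The three pattern vectors `(a, b, 0)/√2`, `(a, 0, c)/√2`,
`(0, b, c)/√2` have inner products `(|w₀| + |w₁|)/√2`, `(|w₀| + |w₂|)/√2`, `(|w₁| + |w₂|)/√2` with
`w`, whose sum is `√2 · (|w₀| + |w₁| + |w₂|) ≥ √2` because `(|w₀| + |w₁| + |w₂|)² ≥ ‖w‖² = 1`.  If all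
three were `< 1/4` the sum would be `< 3/4 < √2`.  Hence one of them is `≥ 1/4`.

Leans on `fccTwoShellPattern`, `fccKissingPattern`, `scaledPattern`, `intVec`, `fccInt`
(`Literature/Geometry/DiscreteGeometry/{KissingPatterns,TwoShellPatterns}.lean`) and Mathlib only.
No new definitions, no named facts.
-/

noncomputable section

namespace Summit.AtomisticToContinuum.Crystallization.Theorems.PhononSlackCertificatesNearFarGlueR

open Literature.Geometry.DiscreteGeometry
open scoped BigOperators RealInnerProductSpace

/-- A sign `a ∈ {1, -1}` with `a · t = |t|`. [folklore] -/
theorem coverFcc_sign (t : ℝ) : ∃ a : ℤ, (a = 1 ∨ a = -1) ∧ (a : ℝ) * t = |t| := by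
  by_cases h : 0 ≤ t
  · exact ⟨1, Or.inl rfl, by rw [Int.cast_one, one_mul, abs_of_nonneg h]⟩
  · exact ⟨-1, Or.inr rfl, by
      rw [Int.cast_neg, Int.cast_one, neg_one_mul, abs_of_neg (not_le.mp h)]⟩

/-- Every integer vector `(p, q, r)` of `fccInt` yields the unit vector `(p, q, r)/√2` of the fcc
two-shell pattern, whose inner product with `w` is `(p w₀ + q w₁ + r w₂)/√2`. [folklore] -/
theorem coverFcc_candidate {p q r : ℤ} (hu : (![p, q, r] : Fin 3 → ℤ) ∈ fccInt)
    (w : EuclideanSpace ℝ (Fin 3)) :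
    ∃ v ∈ fccTwoShellPattern, ‖v‖ = 1 ∧
      ⟪v, w⟫ = ((p : ℝ) * w 0 + (q : ℝ) * w 1 + (r : ℝ) * w 2) / Real.sqrt 2 := by
  have hmem : (Real.sqrt (2 : ℕ))⁻¹ • intVec ![p, q, r] ∈ fccKissingPattern :=
    Finset.mem_image.2 ⟨![p, q, r], hu, rfl⟩
  refine ⟨(Real.sqrt (2 : ℕ))⁻¹ • intVec ![p, q, r], fccKissingPattern_subset hmem,
    norm_eq_one_of_mem_fccKissingPattern hmem, ?_⟩
  rw [real_inner_smul_left, inv_mul_eq_div]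
  simp only [Nat.cast_ofNat, PiLp.inner_apply, RCLike.inner_apply, conj_trivial,
    Fin.sum_univ_three, intVec_apply, Matrix.cons_val_zero, Matrix.cons_val_one,
    Matrix.cons_val_two, Matrix.head_cons, Matrix.tail_cons]
  ring

/-- **The cuboctahedron directions `1/4`-cover the sphere**: for every unit vector `w` some unit
vector `v` of the fcc two-shell pattern has `⟪v, w⟫ ≥ 1/4`. [folklore] -/
theorem stub_coverFcc :
    ∀ w : EuclideanSpace ℝ (Fin 3), ‖w‖ = 1 →
      ∃ v ∈ fccTwoShellPattern, ‖v‖ = 1 ∧ (1 / 4 : ℝ) ≤ ⟪v, w⟫ := by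
  intro w hw
  -- signs of the coordinates
  obtain ⟨a, ha, ha'⟩ := coverFcc_sign (w 0)
  obtain ⟨b, hb, hb'⟩ := coverFcc_sign (w 1)
  obtain ⟨c, hc, hc'⟩ := coverFcc_sign (w 2)
  -- the three signed pattern vectors
  have h01 : (![a, b, 0] : Fin 3 → ℤ) ∈ fccInt := by
    rcases ha with rfl | rfl <;> rcases hb with rfl | rfl <;> decide
  have h02 : (![a, 0, c] : Fin 3 → ℤ) ∈ fccInt := by
    rcases ha with rfl | rfl <;> rcases hc with rfl | rfl <;> decide
  have h12 : (![0, b, c] : Fin 3 → ℤ) ∈ fccInt := by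
    rcases hb with rfl | rfl <;> rcases hc with rfl | rfl <;> decide
  obtain ⟨v01, hv01, hn01, hi01⟩ := coverFcc_candidate h01 w
  obtain ⟨v02, hv02, hn02, hi02⟩ := coverFcc_candidate h02 w
  obtain ⟨v12, hv12, hn12, hi12⟩ := coverFcc_candidate h12 w
  -- `|w₀| + |w₁| + |w₂| ≥ 1` from `‖w‖ = 1`
  have hnorm : w 0 ^ 2 + w 1 ^ 2 + w 2 ^ 2 = 1 := by
    have h := EuclideanSpace.real_norm_sq_eq w
    rw [hw, Fin.sum_univ_three] at h
    linarith
  have habs : 1 ≤ |w 0| + |w 1| + |w 2| := by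
    nlinarith [abs_nonneg (w 0), abs_nonneg (w 1), abs_nonneg (w 2), sq_abs (w 0), sq_abs (w 1),
      sq_abs (w 2), mul_nonneg (abs_nonneg (w 0)) (abs_nonneg (w 1)),
      mul_nonneg (abs_nonneg (w 0)) (abs_nonneg (w 2)),
      mul_nonneg (abs_nonneg (w 1)) (abs_nonneg (w 2))]
  -- `√2 < 3/2`
  have hs2pos : 0 < Real.sqrt 2 := by positivity
  have hs2 : Real.sqrt 2 < 3 / 2 := by
    rw [Real.sqrt_lt' (by norm_num)]
    norm_num
  -- if all three inner products were `< 1/4`, their sum would be `< 3/4 < √2 ≤ √2·(|w₀|+|w₁|+|w₂|)`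
  by_contra hcon
  push Not at hcon
  have c01 := hcon v01 hv01 hn01
  have c02 := hcon v02 hv02 hn02
  have c12 := hcon v12 hv12 hn12
  rw [hi01, div_lt_iff₀ hs2pos] at c01
  rw [hi02, div_lt_iff₀ hs2pos] at c02
  rw [hi12, div_lt_iff₀ hs2pos] at c12
  simp only [Int.cast_zero, zero_mul, add_zero, zero_add] at c01 c02 c12
  linarith

end Summit.AtomisticToContinuum.Crystallization.Theorems.PhononSlackCertificatesNearFarGlueR

end
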